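import Literature.NumberTheory.Rogawski1990.CMLocalAPacketMembers                 -- ★ `Gqs`, `qsForm` (the socket's carrier tokens); brings `cmPrincipalSeries`, `IrrClass.IsConstituentOf`
import Literature.NumberTheory.Automorphic.CMPrincipalSeriesSpherical              -- ★ `rootDeltaChar_borel_eq_one_of_mem_isCompact`; brings Iwasawa `exists_borel_mul_mem_cmLocalIntegralLevel`, `SmoothInductionSphericalLine`
import Literature.NumberTheory.Automorphic.IrreducibleClassesConstituentsIsotypic  -- ★ exchange lemma `isConstituentOf_toRepresentation_of_realisation`, `IsConstituentOf.toRepresentation_or_quotientRep`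
import Literature.NumberTheory.Automorphic.SmoothCharacterAdditive                -- ★ `coe_mem_fixedPoints_of_mem`; brings `fixedPoints_le_map_of_surjective` (exactness of `V ↦ V^K`)
import Literature.NumberTheory.Automorphic.FixedVectorsRankAdditive               -- ★ `finrank_fixedPoints_eq_of_bijective` (`dim V^K` is an invariant of `≅`)
import Literature.NumberTheory.Automorphic.HeckeEigencharacterPackage             -- ★ `IrrClass.IsSpherical`, `isSpherical_mk`
import HarnessLib

/-!
# R90-TF · S1 «Ch. 12 local» — socket A1 (TOP): at a non-split `v`, `i_G(χ)` has AT MOST ONE `K_v`-spherical constituent, and has one only if `χ` is unramified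

Cell `hodgecm-mathlib`, crux H413 (`stmt-HodgeConjecture-24833`, lane `--supports … --as helper`), route of record `HCCMUnconditional`
(no route verbs; count-neutral).  Programme R90-TF (HUMAN RULING «R90-TF SLAB — MAX PUSH»; brief `director/R90-BRIEF.v2.md` 1f40d54518340a35),
section S1 = Ch10-local (base `R90-C10`); seat R90-C10-p03 (g0), dealt BY NAME «p03 → S1#6 `R90.S1.stub_R90_122_sphericalConstituent_unique`
(TOP A1) ROAD IWASAWA + EXACT K-FIXED FUNCTOR» by R90-C10-plan (g0) (EMIT S1 WAVE 1, `R90/STATUS.md` 2026-09-04T15:32:01Z).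
THEOREMS ONLY (no `def`, no instance, no notation, no named fact, no `sorry`); imports ★ Literature only; Lines-free (law L9: the
socket file `Cruxes/H413/Lines/R90_S1_NonsplitLocalPacketsA.lean` imports THIS file at ED. 2 and pays `stub_R90_122_sphericalConstituent_unique`
by `exact sphericalConstituent_unique L`): the statement below is the socket's statement TOKEN FOR TOKEN, with the Lines-side abbreviation
`IsUnramifiedTorusChar L v χ` replaced by its BODY verbatim (`∀ t ∈ T(L⁺_v), t ∈ K_v → χ t = 1`, the hypothesis `hχ` of ★ `isSpherical_cmPrincipalSeries`),
so the payment is a `δ`-unfolding.  HONEST LABEL: HC_CM is proved only modulo the 7 printed citations (2 remaining named inputs: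
hLiu418 = stmt-HodgeConjecture-24832, h413 = stmt-HodgeConjecture-24833) until rung 0 closes; this file proves the printed LOCAL statement
[Rogawski1990, §4.5 p. 45; §12.2 pp. 173–174 with CartierCorvallis1979 §IV.1] at EVERY finite place (no `∀ᶠ` exception is used, no non-split
hypothesis is used) and closes nothing global.

Layout: §1 two GENERIC private lemmas (any topological group, smooth `ρ`, compact `K`): exactness on a realised constituent and «at most one
`K`-spherical constituent when `ρ^K` is a line»; §2 the statement for the GENERIC unitary group `U(σ, Φ_N)(R)` with `G = B · K` (private, over ★
`principalSeries`); §3 the socket on the CM carrier (★ `cmPrincipalSeries L 3 v χ` IS §2's `principalSeries` at `R = Π_{w∣v} L_w`, one `exact`).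

## The mathematics (Cartier §III.3–§IV.1; Bernstein–Zelevinsky 1976 Prop. 2.3)
`G = U(Φ₃)(L⁺_v)`, `K = K_v = U(Φ₃)(𝒪_v)` (★ `cmLocalIntegralLevel`, compact open), `V = i_G(χ)` (★ `cmPrincipalSeries` = `Ind_B^G (χ δ_B^{1/2})`).
* LINE.  `G = B · K` at EVERY `v` (★ Iwasawa `exists_borel_mul_mem_cmLocalIntegralLevel`), so a `K`-fixed `f ∈ V` is determined by `f(1) ∈ ℂ`
  (★ `eq_of_toFun_one_eq`): every `K`-fixed vector is a multiple of any non-zero one.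
* EXACTNESS.  If `⟦r⟧ ≅ N₁ ⁄ N₂` is a `K`-spherical constituent, the non-zero `K`-fixed line of `r` lifts along `N₁ ↠ N₁ ⁄ N₂` (★
  `fixedPoints_le_map_of_surjective`, averaging over the compact `K` on the smooth `N₁`) to a `K`-fixed `x ∈ N₁ ∖ N₂`.
* UNIQUENESS.  Given two spherical constituents `⟦r⟧ ≅ N₁ ⁄ N₂`, `⟦r'⟧ ≅ N₁' ⁄ N₂'` with witnesses `x`, `x'`, LINE gives `x' = a x`, so
  `x ∈ (N₁ ∩ N₁') ∖ (N₂ ∪ N₂')`.  By the exchange lemma (★ `isConstituentOf_toRepresentation_of_realisation`) `⟦r⟧` is a constituent of `N₁'`,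
  hence (★ `toRepresentation_or_quotientRep`) of `N₂'` or of `N₁' ⁄ N₂' ≅ r'`.  Not of `N₂'`: a spherical constituent of `N₂'` would give (EXACTNESS)
  a non-zero `K`-fixed vector in `N₂'`, of which `x ∉ N₂'` is a multiple (LINE).  So `⟦r⟧` is a constituent of the irreducible `N₁' ⁄ N₂'`, i.e.
  `⟦r⟧ = ⟦r'⟧` (★ `IsConstituentOf.eq_of_isIrreducible`).
* UNRAMIFIED.  A spherical constituent gives a non-zero `K`-fixed `f`, so `f(1) ≠ 0` (LINE); for `t ∈ T ∩ K`:
  `f(1) = f(1 · t) = f(t · 1) = χ(t) δ_B^{1/2}(t) f(1)` and `δ_B^{1/2}(t) = 1` (★ `rootDeltaChar_borel_eq_one_of_mem_isCompact`), so `χ(t) = 1`.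

[cite: Rogawski1990, §4.5 p. 45; §12.2 pp. 173–174; §13.3 p. 203] [cite: CartierCorvallis1979, §III.3, §IV.1 Thm. 4.1] [cite: BernsteinZelevinsky1976, §2.3 Prop. 2.3]
-/

set_option autoImplicit false

set_option linter.dupNamespace false

noncomputable section

open NumberField IsDedekindDomain MeasureTheory Filter
open scoped Matrix MatrixGroups

namespace Summit.HodgeConjecture.HodgeConjecture.R90.S1

open Literature.NumberTheory Literature.NumberTheory.Automorphic Literature.NumberTheory.Automorphic.UnitaryGroup
open Literature.NumberTheory.Rogawski1990
open Literature.RepresentationTheory.FiniteGroups Literature.RepresentationTheory.Semisimple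

universe u

/-! ## §1 Generic: exactness of `V ↦ V^K` on a realised constituent, and uniqueness of the spherical constituent on a `K`-fixed LINE -/

/-- **EXACTNESS on a realisation.**  In a SMOOTH `ρ` with `K` compact, a constituent `⟦r⟧ ≅ N₁ ⁄ N₂` whose representative `r` is `K`-spherical
has a `K`-fixed witness `x ∈ N₁ ∖ N₂` (lift the spherical line of `r ≅ N₁ ⁄ N₂` along `N₁ ↠ N₁ ⁄ N₂` by ★ `fixedPoints_le_map_of_surjective`).
[cite: BernsteinZelevinsky1976, §2.3 Prop. 2.3] [cite: CartierCorvallis1979, §III.3] -/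
private theorem exists_mem_fixedPoints_of_realisation {G : Type u} [Group G] [TopologicalSpace G] [IsTopologicalGroup G]
    {V : Type*} [AddCommGroup V] [Module ℂ V] {ρ : Representation ℂ G V} (hρ : ρ.IsSmooth)
    {K : Subgroup G} (hK : IsCompact (K : Set G)) (r : SmoothIrrep G) (hr : r.ρ.IsSpherical K)
    (N₁ N₂ : Subrepresentation ρ)
    (φ : r.ρ.Equiv (N₁.toRepresentation.quotient (N₂.toSubmodule.comap N₁.toSubmodule.subtype)
      fun g _ hx ↦ N₂.apply_mem_toSubmodule g hx)) :
    ∃ x : V, x ∈ ρ.fixedPoints K ∧ x ∈ N₁ ∧ x ∉ N₂ := by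
  -- `N₂` read inside `N₁`, and the quotient `N₁ ⁄ N₂ ≅ r`
  let N₂' : Subrepresentation N₁.toRepresentation :=
    ⟨N₂.toSubmodule.comap N₁.toSubmodule.subtype, fun g _ hx ↦ N₂.apply_mem_toSubmodule g hx⟩
  have φ' : r.ρ.Equiv N₂'.quotientRep := φ
  -- `N₁ ⁄ N₂` is `K`-spherical with `r` (transport of `dim (·)^K` along `≅`), so it has a non-zero `K`-fixed vector `q`
  have hQ : N₂'.quotientRep.IsSpherical K := by
    rw [Representation.isSpherical_iff] at hr ⊢
    rw [← hr]
    exact (Representation.finrank_fixedPoints_eq_of_bijective φ'.toIntertwiningMap (EquivLike.bijective φ') K).symm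
  obtain ⟨q, hq, hq0⟩ := Submodule.exists_mem_ne_zero_of_ne_bot hQ.isUnramified
  -- lifted along `N₁ ↠ N₁ ⁄ N₂` (averaging over the compact `K` on the smooth `N₁`)
  obtain ⟨z, hz, hzq⟩ := Representation.fixedPoints_le_map_of_surjective (hρ.toRepresentation N₁) N₂'.mkQ
    N₂'.mkQ_surjective hK hq
  refine ⟨(z : V), Representation.coe_mem_fixedPoints_of_mem ρ N₁ hz, z.2, fun hz₂ => hq0 ?_⟩
  rw [← hzq]
  exact (N₂'.mkQ_eq_zero_iff z).2 hz₂

/-- **UNIQUENESS OF THE SPHERICAL CONSTITUENT ON A LINE.**  If `ρ` is smooth, `K` compact, and the `K`-fixed vectors of `ρ` lie on a line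
through each of their non-zero elements, then `ρ` has at most one `K`-spherical constituent class (exchange lemma + exactness, see the header).
[cite: CartierCorvallis1979, §IV.1 Thm. 4.1] [cite: BernsteinZelevinsky1976, §2.3 Prop. 2.3] -/
private theorem eq_of_isSpherical_of_fixedPoints_line {G : Type u} [Group G] [TopologicalSpace G] [IsTopologicalGroup G]
    {V : Type*} [AddCommGroup V] [Module ℂ V] {ρ : Representation ℂ G V} (hρ : ρ.IsSmooth)
    {K : Subgroup G} (hK : IsCompact (K : Set G))
    (hline : ∀ x ∈ ρ.fixedPoints K, x ≠ 0 → ∀ y ∈ ρ.fixedPoints K, ∃ a : ℂ, a • x = y)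
    {c c' : IrrClass G} (hc : c.IsConstituentOf ρ) (hc' : c'.IsConstituentOf ρ)
    (hs : c.IsSpherical K) (hs' : c'.IsSpherical K) : c = c' := by
  obtain ⟨r, rfl, N₁, N₂, -, ⟨φ⟩⟩ := hc
  obtain ⟨r', rfl, N₁', N₂', -, ⟨φ'⟩⟩ := hc'
  rw [IrrClass.isSpherical_mk] at hs hs'
  obtain ⟨x, hxK, hx₁, hx₂⟩ := exists_mem_fixedPoints_of_realisation hρ hK r hs N₁ N₂ φ
  obtain ⟨x', hx'K, hx'₁, hx'₂⟩ := exists_mem_fixedPoints_of_realisation hρ hK r' hs' N₁' N₂' φ'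
  have hx0 : x ≠ 0 := fun h => hx₂ (by rw [h]; exact N₂.toSubmodule.zero_mem)
  have hx'0 : x' ≠ 0 := fun h => hx'₂ (by rw [h]; exact N₂'.toSubmodule.zero_mem)
  -- LINE: `x' = a • x`, `a ≠ 0`, so `x ∈ N₁' ∖ N₂'`
  obtain ⟨a, rfl⟩ := hline x hxK hx0 x' hx'K
  have ha : a ≠ 0 := by
    rintro rfl
    exact hx'0 (zero_smul ℂ x)
  have hx₁' : x ∈ N₁' := by
    have h := N₁'.toSubmodule.smul_mem a⁻¹ hx'₁
    rwa [smul_smul, inv_mul_cancel₀ ha, one_smul] at h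
  have hx₂' : x ∉ N₂' := fun h => hx'₂ (N₂'.toSubmodule.smul_mem a h)
  -- EXCHANGE: `⟦r⟧` is a constituent of `N₁'`, hence of `N₂'` (read inside `N₁'`) or of `N₁' ⁄ N₂' ≅ r'`
  have h1 : (IrrClass.mk r).IsConstituentOf N₁'.toRepresentation :=
    IrrClass.isConstituentOf_toRepresentation_of_realisation r N₁ N₂ φ N₁' hx₁ hx₁' hx₂
  let M : Subrepresentation N₁'.toRepresentation :=
    ⟨N₂'.toSubmodule.comap N₁'.toSubmodule.subtype, fun g _ hx ↦ N₂'.apply_mem_toSubmodule g hx⟩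
  have φ'' : r'.ρ.Equiv M.quotientRep := φ'
  rcases h1.toRepresentation_or_quotientRep M with h2 | h2
  · -- impossible: a spherical constituent of `N₂'` puts a non-zero `K`-fixed vector in `N₂'`, and `x ∉ N₂'` is a multiple of it
    exfalso
    obtain ⟨s, hs₁, P₁, P₂, -, ⟨ψ⟩⟩ := h2
    have hsK : s.ρ.IsSpherical K := by
      rw [← IrrClass.isSpherical_mk, hs₁, IrrClass.isSpherical_mk]
      exact hs
    obtain ⟨z, hzK, -, hz₂⟩ := exists_mem_fixedPoints_of_realisation ((hρ.toRepresentation N₁').toRepresentation M) hK s hsK P₁ P₂ ψ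
    have hz0 : ((z : N₁'.toSubmodule) : V) ≠ 0 := fun h => hz₂ (by
      have hz' : z = 0 := Subtype.ext (Subtype.ext h)
      rw [hz']
      exact P₂.toSubmodule.zero_mem)
    have hzV : ((z : N₁'.toSubmodule) : V) ∈ ρ.fixedPoints K :=
      Representation.coe_mem_fixedPoints_of_mem ρ N₁' (Representation.coe_mem_fixedPoints_of_mem N₁'.toRepresentation M hzK)
    have hzN : ((z : N₁'.toSubmodule) : V) ∈ N₂'.toSubmodule := z.2
    obtain ⟨b, hb⟩ := hline _ hzV hz0 x hxK
    exact hx₂' (hb ▸ N₂'.toSubmodule.smul_mem b hzN)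
  · haveI : M.quotientRep.IsIrreducible := Representation.isIrreducible_of_equiv φ''
    have h3 : (IrrClass.mk r').IsConstituentOf M.quotientRep :=
      (IrrClass.isConstituentOf_congr φ'' _).1 (IrrClass.isConstituentOf_mk_self r')
    exact h2.eq_of_isIrreducible h3

/-! ## §2 Generic `U(σ, Φ_N)(R)`: the principal series `i_G(χ) = Ind_B^G (χ δ_B^{1/2})` when `G = B · K` -/

/-- **The socket, generically**: for `G = U(σ, Φ_N)(R)` over a `T₁` topological ring `R`, a compact open `K ≤ G` with `G = B · K`, and any
character `χ` of the diagonal torus: (u) two `K`-spherical constituents of `i_G(χ)` (★ `principalSeries`) coincide; (r) if one exists, `χ` is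
trivial on `T ∩ K`.  LINE from ★ `eq_of_toFun_one_eq` (`f ↦ f(1)` is injective on `i_G(χ)^K`), then §1; (r) reads `f(t) = f(1)` (`t = 1 · t`, `t ∈ K`)
against `f(t) = χ(t) δ_B^{1/2}(t) f(1)` (`t = t · 1`) with `δ_B^{1/2}(t) = 1` (★ `rootDeltaChar_borel_eq_one_of_mem_isCompact`).
[cite: Rogawski1990, §4.5 p. 45; §12.2 pp. 173–174] [cite: CartierCorvallis1979, §III.3, §IV.1 Thm. 4.1] [cite: BernsteinZelevinsky1976, §2.3 Prop. 2.3] -/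
private theorem principalSeries_sphericalConstituent_unique {R : Type*} [CommRing R] (σ : R →+* R) {N : ℕ}
    (J : Matrix (Fin N) (Fin N) R) (hJ : J = (StdForm.antidiagonal N).over R)
    [TopologicalSpace R] [IsTopologicalRing R] [T1Space R] [LocallyCompactSpace ↥(borelU σ J)]
    {K : Subgroup ↥(unitaryGroupOfForm σ J)} (hKc : IsCompact (K : Set ↥(unitaryGroupOfForm σ J)))
    (hGK : ∀ g : ↥(unitaryGroupOfForm σ J), ∃ b : ↥(borelTriple σ J hJ).P, ∃ κ ∈ K, g = (b : ↥(unitaryGroupOfForm σ J)) * κ)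
    (χ : ↥(torusU σ J) →* ℂˣ) :
    (∀ c c' : IrrClass ↥(unitaryGroupOfForm σ J),
        c.IsConstituentOf (principalSeries σ J hJ χ) → c'.IsConstituentOf (principalSeries σ J hJ χ) →
        c.IsSpherical K → c'.IsSpherical K → c = c') ∧
      ((∃ c : IrrClass ↥(unitaryGroupOfForm σ J), c.IsConstituentOf (principalSeries σ J hJ χ) ∧ c.IsSpherical K) →
        ∀ t : ↥(torusU σ J), (t : ↥(unitaryGroupOfForm σ J)) ∈ K → χ t = 1) := by
  -- `i_G(χ) = Ind_B^G τ`, `τ = χ δ_B^{1/2}` read on `B` through the Levi projection (`rfl` across ★ `principalSeries = normalizedInd = smoothIndRep`)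
  rw [show principalSeries σ J hJ χ = Representation.smoothIndRep (borelTriple σ J hJ).P
    (Representation.twist (((Representation.trivial ℂ ↥(torusU σ J) ℂ).twist χ).comp (borelTriple σ J hJ).proj)
      (rootDeltaChar (borelTriple σ J hJ).P)) from rfl]
  have hρ := Representation.isSmooth_smoothInd (borelTriple σ J hJ).P
    (Representation.twist (((Representation.trivial ℂ ↥(torusU σ J) ℂ).twist χ).comp (borelTriple σ J hJ).proj)
      (rootDeltaChar (borelTriple σ J hJ).P))
  -- LINE: a `K`-fixed `f` is determined by `f(1)` (★ `eq_of_toFun_one_eq`); a non-zero one has `f(1) ≠ 0`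
  have hone : ∀ f ∈ (Representation.smoothIndRep (borelTriple σ J hJ).P
      (Representation.twist (((Representation.trivial ℂ ↥(torusU σ J) ℂ).twist χ).comp (borelTriple σ J hJ).proj)
        (rootDeltaChar (borelTriple σ J hJ).P))).fixedPoints K, f ≠ 0 → f.toFun 1 ≠ 0 :=
    fun f hf hf0 h0 => hf0 (Representation.eq_of_toFun_one_eq _ hGK hf (Submodule.zero_mem _) (by rw [h0]; rfl))
  have hline : ∀ f ∈ (Representation.smoothIndRep (borelTriple σ J hJ).P
      (Representation.twist (((Representation.trivial ℂ ↥(torusU σ J) ℂ).twist χ).comp (borelTriple σ J hJ).proj)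
        (rootDeltaChar (borelTriple σ J hJ).P))).fixedPoints K, f ≠ 0 →
      ∀ f' ∈ (Representation.smoothIndRep (borelTriple σ J hJ).P
        (Representation.twist (((Representation.trivial ℂ ↥(torusU σ J) ℂ).twist χ).comp (borelTriple σ J hJ).proj)
          (rootDeltaChar (borelTriple σ J hJ).P))).fixedPoints K, ∃ a : ℂ, a • f = f' := by
    intro f hf hf0 f' hf'
    refine ⟨f'.toFun 1 * (f.toFun 1)⁻¹, Representation.eq_of_toFun_one_eq _ hGK (Submodule.smul_mem _ _ hf) hf' ?_⟩
    rw [Representation.SmoothInd.toFun_smul, Pi.smul_apply, smul_eq_mul, inv_mul_cancel_right₀ (hone f hf hf0)]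
  refine ⟨fun c c' hc hc' hs hs' => eq_of_isSpherical_of_fixedPoints_line hρ hKc hline hc hc' hs hs', ?_⟩
  -- (r): a spherical constituent gives a non-zero `K`-fixed `f` (§1); read `f(t)`, `t ∈ T ∩ K`, along `t = t · 1` and `t = 1 · t`
  rintro ⟨c, hc, hs⟩ t ht
  obtain ⟨r, rfl, N₁, N₂, -, ⟨φ⟩⟩ := hc
  rw [IrrClass.isSpherical_mk] at hs
  obtain ⟨f, hf, -, hf₂⟩ := exists_mem_fixedPoints_of_realisation hρ hKc r hs N₁ N₂ φ
  have hf0 : f ≠ 0 := fun h => hf₂ (by rw [h]; exact N₂.toSubmodule.zero_mem)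
  have h1 : f.toFun 1 ≠ 0 := hone f hf hf0
  -- `t` as an element of `B`; `proj t = t`; `δ_B^{1/2}(t) = 1`
  let b : ↥(borelTriple σ J hJ).P := ⟨t, torusU_le_borelU σ J t.2⟩
  have hproj : (borelTriple σ J hJ).proj b = t := Subtype.ext (ParabolicTriple.proj_apply_of_mem_M _ b t.2)
  have hδ : rootDeltaChar (borelTriple σ J hJ).P b = 1 := rootDeltaChar_borel_eq_one_of_mem_isCompact σ J hJ hKc b ht
  have ht₁ := Representation.toFun_eq_of_mem_fixedPoints _ hGK hf (t : ↥(unitaryGroupOfForm σ J)) b 1 (Subgroup.one_mem K)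
    (mul_one _).symm
  have ht₂ := Representation.toFun_eq_of_mem_fixedPoints _ hGK hf (t : ↥(unitaryGroupOfForm σ J)) 1 _ ht (one_mul _).symm
  rw [map_one, Module.End.one_apply] at ht₂
  rw [ht₂, Representation.twist_apply, hδ, Units.val_one, one_smul, MonoidHom.comp_apply, Representation.twist_apply,
    Representation.trivial_apply, hproj, smul_eq_mul] at ht₁
  -- `ht₁ : f 1 = χ t * f 1`
  exact Units.val_eq_one.1 ((mul_eq_right₀ h1).1 ht₁.symm)

/-! ## §3 The socket A1 of S1 on the CM carrier `U(Φ₃)(L⁺_v)`, at EVERY finite place of `L⁺` -/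

variable (L : Type) [Field L] [NumberField L] [IsCMField L]

/-- **SOCKET A1 «SocketUniqueSphericalConstituent» of `Cruxes/H413/Lines/R90_S1_NonsplitLocalPacketsA.lean`, PROVED** (token for token, with
`IsUnramifiedTorusChar L v χ` unfolded to its body): at almost every (in fact EVERY) finite place `v` of `L⁺` (the non-split guard is not used),
for every character `χ` of the diagonal torus of `G = U(Φ₃)(L⁺_v)`, (u) any two `K_v`-spherical Jordan–Hölder constituents of `i_G(χ)` (★
`cmPrincipalSeries L 3 v χ`, `K_v =` ★ `cmLocalIntegralLevel L 3 Φ₃ v`) coincide, and (r) if a `K_v`-spherical constituent exists then `χ` is trivial on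
`T ∩ K_v`.  Road: Iwasawa `G = B · K_v` (★ `exists_borel_mul_mem_cmLocalIntegralLevel`, every `v`) ⇒ `(i_G χ)^{K_v}` is a line through `f ↦ f(1)` (★
`eq_of_toFun_one_eq`) + exactness of `V ↦ V^{K_v}` (★ `fixedPoints_le_map_of_surjective`) + the exchange lemma (§1); (r) from `f(t) = χ(t) δ_B^{1/2}(t) f(1)` and
`δ_B^{1/2} = 1` on `B ∩ K_v` (★ `rootDeltaChar_borel_eq_one_of_mem_isCompact`).  The converse of (r) is ★ `isSpherical_cmPrincipalSeries`.
[cite: Rogawski1990, §4.5 p. 45; §12.2 pp. 173–174; §13.3 p. 203] [cite: CartierCorvallis1979, §III.3, §IV.1 Thm. 4.1] [cite: BernsteinZelevinsky1976, §2.3 Prop. 2.3] -/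
theorem sphericalConstituent_unique :
    ∀ᶠ v : HeightOneSpectrum (𝓞 ↥(maximalRealSubfield L)) in cofinite,
      (∀ w : PlacesOver L v, IsCMField.complexConj L • w.1 = w.1) →
      ∀ χ : ↥(torusU (conjLocal L (IsCMField.complexConj L) v) (cmLocalForm L 3 v)) →* ℂˣ,
        (∀ c c' : IrrClass (Gqs L v),
            c.IsConstituentOf (cmPrincipalSeries L 3 v χ) → c'.IsConstituentOf (cmPrincipalSeries L 3 v χ) →
            c.IsSpherical (cmLocalIntegralLevel L 3 (qsForm L) v) → c'.IsSpherical (cmLocalIntegralLevel L 3 (qsForm L) v) → c = c') ∧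
        ((∃ c : IrrClass (Gqs L v), c.IsConstituentOf (cmPrincipalSeries L 3 v χ) ∧ c.IsSpherical (cmLocalIntegralLevel L 3 (qsForm L) v)) →
            ∀ t : ↥(torusU (conjLocal L (IsCMField.complexConj L) v) (cmLocalForm L 3 v)),
              (t : ↥(unitaryGroupOfForm (conjLocal L (IsCMField.complexConj L) v) (cmLocalForm L 3 v))) ∈
                cmLocalIntegralLevel L 3 (Matrix.of fun i j : Fin 3 => if i.val + j.val + 1 = 3 then (1 : L) else 0) v → χ t = 1) := by
  refine Filter.Eventually.of_forall fun v _ χ => ?_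
  haveI := locallyCompactSpace_cmBorelU L 3 v
  have hK := isCompact_isOpen_cmLocalIntegralLevel L 3 (Matrix.of fun i j : Fin 3 => if i.val + j.val + 1 = 3 then (1 : L) else 0) v
  -- §2 at `R = Π_{w ∣ v} L_w`, `σ = c ⊗ 1`, `J = Φ₃`, `K = K_v` (compact open ★), `G = B · K_v` (★ Iwasawa, every `v`); `cmPrincipalSeries` IS this `principalSeries`
  exact principalSeries_sphericalConstituent_unique (conjLocal L (IsCMField.complexConj L) v) (cmLocalForm L 3 v)
    (cmLocalForm_eq_over L 3 v) hK.1 (exists_borel_mul_mem_cmLocalIntegralLevel L 3 v) χ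

end Summit.HodgeConjecture.HodgeConjecture.R90.S1

end
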